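import Summits.ResolutionOfSingularities.ResolutionOfSingularities.Theorems.WildConesCampaignW46TjurinaInvariance
import Mathlib.RingTheory.MvPowerSeries.Rename
import HarnessLib

/-!
# [OURS · L1 W4.6, rungs (i)/(ii) — the dictionary, SCHEME HALF, brick 11b] The Tjurina ideal under renaming of the
# variables, and brick 11 for the germ index `Option (Fin n)` of `κ⟦z,u⟧`

Cell res-hironaka (LADDER-RESOLUTION rung L, D-0089), slot W4.6, seat res-L1-s46-pv-2 (gen 2). Host: route
`WildCones`, crux `ClassicalRegimes` (stmt-ResolutionOfSingularities-16884), `--supports … --as helper`.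

HONEST FRAMING. Everything here is OURS — bookkeeping: the tree's partial derivatives
(`Literature.RingTheory.MvPowerSeries.pd`) commute with renaming the variables along an equivalence (Mathlib
`MvPowerSeries.rename`), so the Tjurina ideal is transported by `renameEquiv` and brick 11
(`…TjurinaInvariance.lean`, index `Fin m`) holds for the index `Option (Fin n)` of the germ ring `κ⟦z,u⟧` of bricks 2–3
(`finite_tjurina_iff_of_algEquiv_option`). NOTHING here is a statement of H. Hironaka's manuscript [Hironaka2017];
no FACT-LIST premise. AI review is weaker than expert review.

References: brick 11 of this seat. [folklore]
-/

noncomputable section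

-- single-problem summit: the doubled namespace component `ResolutionOfSingularities` is forced
set_option linter.dupNamespace false

open scoped BigOperators Classical
open MvPowerSeries IsLocalRing

namespace Summit.ResolutionOfSingularities.ResolutionOfSingularities.Theorems

namespace CampaignW46.AtomGerm

open Literature.RingTheory.MvPowerSeries (pd coeff_pd)

variable {κ : Type} [Field κ]

/-! ## Partial derivatives commute with renaming along an equivalence -/

/-- Every exponent on `τ` is the push-forward along `ε : σ ≃ τ` of an exponent on `σ`. [folklore] -/
theorem embDomain_equivMapDomain_symm {σ τ : Type} (ε : σ ≃ τ) (y : τ →₀ ℕ) :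
    Finsupp.embDomain ε.toEmbedding (y.equivMapDomain ε.symm) = y := by
  ext t
  conv_lhs => rw [← ε.apply_symm_apply t]
  rw [show (ε (ε.symm t)) = ε.toEmbedding (ε.symm t) from rfl, Finsupp.embDomain_apply_self,
    Finsupp.equivMapDomain_apply, Equiv.symm_symm, Equiv.apply_symm_apply]

/-- **`∂/∂X_{ε s} (rename ε f) = rename ε (∂f/∂X_s)`** for an equivalence of index types. [folklore] -/
theorem pd_rename_equiv {σ τ : Type} [Fintype σ] [Fintype τ] (ε : σ ≃ τ) (s : σ) (f : MvPowerSeries σ κ) :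
    pd (ε s) (rename ε f) = rename ε (pd s f) := by
  ext y
  obtain ⟨x, rfl⟩ : ∃ x : σ →₀ ℕ, y = Finsupp.embDomain ε.toEmbedding x :=
    ⟨y.equivMapDomain ε.symm, (embDomain_equivMapDomain_symm ε y).symm⟩
  have hre : (rename (ε : σ → τ) : MvPowerSeries σ κ →ₐ[κ] MvPowerSeries τ κ) = rename (ε.toEmbedding : σ → τ) := rfl
  rw [coeff_pd, hre, coeff_embDomain_rename,
    show Finsupp.embDomain ε.toEmbedding x + Finsupp.single (ε s) 1 =
      Finsupp.embDomain ε.toEmbedding (x + Finsupp.single s 1) by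
        rw [Finsupp.embDomain_add, Finsupp.embDomain_single]; rfl,
    coeff_embDomain_rename, coeff_pd,
    show (Finsupp.embDomain ε.toEmbedding x) (ε s) = x s from Finsupp.embDomain_apply_self _ x s]

/-- The Tjurina ideal is transported by renaming: `T(rename ε F) = rename ε (T(F))`. [folklore] -/
theorem tjurina_rename_eq_map {σ τ : Type} [Fintype σ] [Fintype τ] (ε : σ ≃ τ) (F : MvPowerSeries σ κ) :
    Ideal.span {rename ε F} ⊔ Ideal.span (Set.range fun t : τ => pd t (rename ε F)) =
      (Ideal.span {F} ⊔ Ideal.span (Set.range fun s : σ => pd s F)).map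
        (rename ε : MvPowerSeries σ κ →ₐ[κ] MvPowerSeries τ κ) := by
  rw [Ideal.map_sup, Ideal.map_span, Set.image_singleton, Ideal.map_span, ← Set.range_comp]
  congr 1
  apply le_antisymm
  · rw [Ideal.span_le]
    rintro _ ⟨t, rfl⟩
    refine Ideal.subset_span ⟨ε.symm t, ?_⟩
    rw [Function.comp_apply, ← pd_rename_equiv, Equiv.apply_symm_apply]
  · rw [Ideal.span_le]
    rintro _ ⟨s, rfl⟩
    refine Ideal.subset_span ⟨ε s, ?_⟩
    dsimp only
    rw [Function.comp_apply, pd_rename_equiv]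

/-- Finiteness of the Tjurina algebra is invariant under renaming the variables. [folklore] -/
theorem finite_tjurina_iff_rename {σ τ : Type} [Fintype σ] [Fintype τ] (ε : σ ≃ τ) (F : MvPowerSeries σ κ) :
    Module.Finite κ (MvPowerSeries τ κ ⧸
        (Ideal.span {rename ε F} ⊔ Ideal.span (Set.range fun t : τ => pd t (rename ε F)))) ↔
      Module.Finite κ (MvPowerSeries σ κ ⧸ (Ideal.span {F} ⊔ Ideal.span (Set.range fun s : σ => pd s F))) := by
  have e := Ideal.quotientEquivAlg (Ideal.span {F} ⊔ Ideal.span (Set.range fun s : σ => pd s F))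
    (Ideal.span {rename ε F} ⊔ Ideal.span (Set.range fun t : τ => pd t (rename ε F))) (renameEquiv κ ε)
    (tjurina_rename_eq_map ε F)
  exact ⟨fun h => Module.Finite.equiv e.symm.toLinearEquiv, fun h => Module.Finite.equiv e.toLinearEquiv⟩

/-- [OURS · L1 W4.6 — DICTIONARY, Isol is intrinsic, germ index `Option (Fin n)`; NOT a statement of the manuscript]
**Brick 11 for `κ⟦z,u⟧ = MvPowerSeries (Option (Fin n)) κ`**: for a `κ`-algebra automorphism `θ` and a unit `w`, the
Tjurina algebra of `w · θF` is finite over `κ` iff that of `F` is. [folklore] -/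
theorem finite_tjurina_iff_of_algEquiv_option {n : ℕ}
    (θ : MvPowerSeries (Option (Fin n)) κ ≃ₐ[κ] MvPowerSeries (Option (Fin n)) κ)
    (F w : MvPowerSeries (Option (Fin n)) κ) (hw : IsUnit w) :
    Module.Finite κ (MvPowerSeries (Option (Fin n)) κ ⧸
        (Ideal.span {w * θ F} ⊔ Ideal.span (Set.range fun j : Option (Fin n) => pd j (w * θ F)))) ↔
      Module.Finite κ (MvPowerSeries (Option (Fin n)) κ ⧸
        (Ideal.span {F} ⊔ Ideal.span (Set.range fun i : Option (Fin n) => pd i F))) := by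
  set ε : Option (Fin n) ≃ Fin (n + 1) := (finSuccEquiv n).symm with hε
  set ρ : MvPowerSeries (Option (Fin n)) κ ≃ₐ[κ] MvPowerSeries (Fin (n + 1)) κ := renameEquiv κ ε with hρ
  have hρ_apply : ∀ G, ρ G = rename ε G := fun G => rfl
  -- transport both sides to `Fin (n+1)`
  rw [← finite_tjurina_iff_rename ε (w * θ F), ← finite_tjurina_iff_rename ε F]
  -- `rename ε (w θ F) = (ρ w) · (ρ θ ρ⁻¹) (ρ F)`
  have hG : rename ε (w * θ F) = ρ w * (ρ.symm.trans (θ.trans ρ)) (rename ε F) := by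
    rw [← hρ_apply, map_mul]
    congr 1
    rw [AlgEquiv.trans_apply, AlgEquiv.trans_apply, ← hρ_apply F, AlgEquiv.symm_apply_apply]
  rw [hG]
  exact finite_tjurina_iff_of_algEquiv (ρ.symm.trans (θ.trans ρ)) (rename ε F) (ρ w) (hw.map ρ)

end CampaignW46.AtomGerm

end Summit.ResolutionOfSingularities.ResolutionOfSingularities.Theorems

end
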